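import Summits.BirchSwinnertonDyer.BirchSwinnertonDyer.Theorems.KolyvaginRankRigidityAtTwoTransverseEigenAtTwo
import Summits.BirchSwinnertonDyer.BirchSwinnertonDyer.Theorems.KolyvaginRankRigidityAtTwoSignedRefillSupplyAtTwo
import HarnessLib

/-!
# Crux U1 `KolyvaginBoundedDefectAtTwo` (stmt-BirchSwinnertonDyer-28083), LINE 17 `kolyvagin_swap` —
# SRF · SHAPE REFILL AT 2 (pen bsd-idea-1 v8.1, `line17/SWalphaSplit.lean` l.268–286 = `kolyvagin_swap_v81.lean` l.1690–1700, stub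
# `stub_shapeRefillAtTwo`, one of the three typed M-stubs {ES, SC, SRF} from which SWα⁗ is derived in the kernel) — PROVED, `gR a = 2a + 8`

Width seat `bsd-line-krr2-p2` g18 (ONE READER on LINE 17); `--supports stmt-BirchSwinnertonDyer-28083` (helper). HONEST FRAMING: SRF is a typed
sub-target of the pen's (unregistered) v8.1 split of SWα⁗; nothing here proves ES, SC, SWα⁗, U1, a rung or BSD. BSD is NOT proved.

## Statement
`shapeRefillAtTwo` = the pen's `ShapeRefillAtTwo` BYTE-FOR-BYTE with its two `OppShape` terms UNFOLDED (`OppShape W K ι τ M e u a 0` in the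
hypothesis, `OppShape W K ι τ M (e * ℓ) u (gR a) 1` in the conclusion; the v7.x/v8.x definitions are not an importable module — with `OppShape` in
scope the stub closes by `exact shapeRefillAtTwo` through definitional unfolding): if the `(−u)`-part of `H_{𝓕(e)}(K, E[2^M])` has shape
`Sh(0, a)` and `ℓ ∤ e` is a Kolyvagin prime (`eℓ` square-free Kolyvagin, margin one), then the `(−u)`-part of `H_{𝓕(eℓ)}` has shape
`Sh(1, 2a + 8)`: ONE exact `(−u)`-class `x ∈ H_{𝓕(eℓ)}`, nearly free modulo phantoms (`b x ≡ 0 ⟹ 2^(M−2a−8) ∣ b`), absorbing every exact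
`(−u)`-class `y` (`2^(2a+8) y ≡ β x`).

## Proof
`x` := the in-situ signed supply at the place `λ ∣ ℓ` (`RegularRefill.exists_eigen_mem_selmerF_of_symmetrised_cut`, p723417: GLOBAL exact class with
`2^(M−a−8) loc_λ x ≠ 0` — the LOCAL order is what SRF needs); near-freeness by Φ-KILL at `λ` and the local order
(`two_pow_dvd_of_zsmul_eq_zero_of_ne_zero`); absorption: `#𝒯_λ^{(−u)} = #Kum_λ^{(−u)} ≤ 2^(M+1)` WITHOUT describing `𝒯_λ`
(`natCard_transverse_inf_ker_le`, the signed eigen-count of p728166) so `2^(a+8) loc y = t loc x` (`exists_zsmul_eq_zsmul_of_transverse_eigen`);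
`w = 2^(a+8) y − t x` is locally trivial at `λ`, hence in `H_{𝓕(e)}` (`H¹_{𝓕(eℓ)[λ ↦ Kum]} = H_{𝓕(e)}`, g15), exact, so the shape `Sh(0,a)` kills
`2^a w` modulo phantoms: `2^(2a+8) y ≡ 2^a t x`. The corner `M < a + 8` is trivial (frame `x = 0`).
References (locators only; no cited FACT is declared): [cite: MazurRubin2004, §4.1 Prop. 4.1.5, Lemma 4.1.7, Cor. 4.1.9]
[cite: Howard2004HeegnerKolyvagin, §1.5–1.6] [cite: GrossLMS1991, §9] [cite: Jetchev2008, §3.4.1].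
Design: no definitions; `K : Type`; axioms `propext`, `Classical.choice`, `Quot.sound`.
-/

set_option autoImplicit false
-- the Theorems namespace of this sub repeats the summit name by design (D-0017 nested layout)
set_option linter.dupNamespace false

noncomputable section

open scoped Classical
open Function NumberField IsDedekindDomain WeierstrassCurve Field Finset
open Literature.NumberTheory.EllipticCurves Literature.NumberTheory.EllipticCurves.Jetchev2008
open Literature.NumberTheory.EllipticCurves.KolyvaginPairing
open Literature.NumberTheory.GaloisRepresentations Literature.NumberTheory.GaloisCohomology
open Literature.NumberTheory.GaloisRepresentations.DiscreteGaloisModule (transverseSubgroup SelmerStructure)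
open Literature.NumberTheory.Automorphic Literature.NumberTheory
open Summit.BirchSwinnertonDyer.Rank1Residual
open Summit.BirchSwinnertonDyer.Rank1Residual.JET.SelmerVocabulary
open Summit.BirchSwinnertonDyer.Rank1Residual.JET.GlobalDuality (smul_place_eq_self_of_natCast_mem)
open Summit.BirchSwinnertonDyer.BirchSwinnertonDyer.Theorems.KolyvaginLowerBoundAtTwo (exists_weilDatum_liftAut_two_pow
  weil_equivariant_of_isLiftOfAut)

namespace Summit.BirchSwinnertonDyer.BirchSwinnertonDyer.Theorems.KolyvaginAtTwo.RegularWalk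

/-- `p • (s • y) − t • (s • x) = s • (p • y − t • x)` (generic spelling, safe for `H¹(K, E[2^M])`). [folklore] -/
theorem zsmul_zsmul_sub_zsmul_zsmul {G : Type*} [AddCommGroup G] (s p t : ℤ) (y x : G) :
    p • (s • y) - t • (s • x) = s • (p • y - t • x) := by
  rw [smul_sub, smul_smul, smul_smul, smul_smul, smul_smul, mul_comm p s, mul_comm t s]

set_option maxHeartbeats 800000 in
/-- **SRF `ShapeRefillAtTwo` (pen v8.1, VERBATIM with both `OppShape` terms unfolded), `gR a = 2a + 8`.** See the module docstring.
[cite: MazurRubin2004, §4.1 Prop. 4.1.5, Lemma 4.1.7, Cor. 4.1.9] [cite: Howard2004HeegnerKolyvagin, §1.5–1.6] [cite: GrossLMS1991, §9] -/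
theorem shapeRefillAtTwo :
    ∀ (W : WeierstrassCurve ℚ) [W.IsElliptic] [W.IsGloballyMinimal], ¬ W.HasCM → (Literature.NumberTheory.EllipticCurves.Rank1Residual.GoodOrd W 2 ∨ Literature.NumberTheory.EllipticCurves.Rank1Residual.Mult W 2) → (∀ m : ℕ, W.HasSurjectiveModNGaloisRep (2 ^ m : ℕ)) → ∀ (K : Type) [Field K] [NumberField K], Literature.NumberTheory.EllipticCurves.IsImaginaryQuadratic K → ∀ [NeZero (W.conductorNorm ℤ)], Literature.NumberTheory.EllipticCurves.SatisfiesHeegnerHypothesis (W.conductorNorm ℤ) K → Odd (NumberField.discr K) → NumberField.discr K ≠ -3 → AddSubgroup.torsionBy (W.baseChange K).toAffine.Point (2 : ℤ) = ⊥ → Literature.NumberTheory.EllipticCurves.SatisfiesHeegnerHypothesis 2 K → ∀ (Dt : Literature.NumberTheory.EllipticCurves.ModularForms.ModularParametrizationData W (W.conductorNorm ℤ)) (β : ℤ) (ι : K →+* ℂ) [∀ k : ℕ, NumberField (ringClassField K ι k)], (4 * (W.conductorNorm ℤ : ℤ)) ∣ β ^ 2 - NumberField.discr K →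
    ∀ (τ : K ≃ₐ[ℚ] K), τ ≠ 1 → ∀ (u : ℤ), (u = 1 ∨ u = -1) →
    ∃ gR : ℕ → ℕ, ∀ (M e ℓ a : ℕ),
      Literature.NumberTheory.EllipticCurves.KolyvaginDescent.KolSupp (Literature.NumberTheory.EllipticCurves.Zhang2014.IsKolyvaginPrime (W.conductorNorm ℤ) W K 2) (e * ℓ) →
      ℓ.Prime → ¬ ℓ ∣ e → 1 ≤ M → (((M + 1 : ℕ) : ℕ) : ℕ∞) ≤ Literature.NumberTheory.EllipticCurves.Zhang2014.levelIndex W 2 (e * ℓ) →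
      (∃ (g : Fin 0 → galH1Torsion (W.baseChange K) ((2 ^ M : ℕ) : ℤ)),
        (∀ i, g i ∈ Jetchev2008.modifiedSelmerGroup W K ι ((2 ^ M : ℕ) : ℤ) e) ∧
        (∀ i, conjAct W τ ((2 ^ M : ℕ) : ℤ) (g i) = (-u) • g i) ∧
        (∀ b : Fin 0 → ℤ, (∀ σ ∈ torsionFixing (W.baseChange K) ((2 ^ (M + 1) : ℕ) : ℤ),
            h1Eval (W.baseChange K) ((2 ^ M : ℕ) : ℤ) (∑ i, b i • g i) σ = 0) → ∀ i, (2 : ℤ) ^ (M - a) ∣ b i) ∧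
        (∀ y : galH1Torsion (W.baseChange K) ((2 ^ M : ℕ) : ℤ), y ∈ Jetchev2008.modifiedSelmerGroup W K ι ((2 ^ M : ℕ) : ℤ) e →
          conjAct W τ ((2 ^ M : ℕ) : ℤ) y = (-u) • y →
          ∃ b : Fin 0 → ℤ, ∀ σ ∈ torsionFixing (W.baseChange K) ((2 ^ (M + 1) : ℕ) : ℤ),
            h1Eval (W.baseChange K) ((2 ^ M : ℕ) : ℤ) (((2 : ℤ) ^ a) • y - ∑ i, b i • g i) σ = 0)) →
      (∃ (g : Fin 1 → galH1Torsion (W.baseChange K) ((2 ^ M : ℕ) : ℤ)),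
        (∀ i, g i ∈ Jetchev2008.modifiedSelmerGroup W K ι ((2 ^ M : ℕ) : ℤ) (e * ℓ)) ∧
        (∀ i, conjAct W τ ((2 ^ M : ℕ) : ℤ) (g i) = (-u) • g i) ∧
        (∀ b : Fin 1 → ℤ, (∀ σ ∈ torsionFixing (W.baseChange K) ((2 ^ (M + 1) : ℕ) : ℤ),
            h1Eval (W.baseChange K) ((2 ^ M : ℕ) : ℤ) (∑ i, b i • g i) σ = 0) → ∀ i, (2 : ℤ) ^ (M - (gR a)) ∣ b i) ∧
        (∀ y : galH1Torsion (W.baseChange K) ((2 ^ M : ℕ) : ℤ), y ∈ Jetchev2008.modifiedSelmerGroup W K ι ((2 ^ M : ℕ) : ℤ) (e * ℓ) →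
          conjAct W τ ((2 ^ M : ℕ) : ℤ) y = (-u) • y →
          ∃ b : Fin 1 → ℤ, ∀ σ ∈ torsionFixing (W.baseChange K) ((2 ^ (M + 1) : ℕ) : ℤ),
            h1Eval (W.baseChange K) ((2 ^ M : ℕ) : ℤ) (((2 : ℤ) ^ (gR a)) • y - ∑ i, b i • g i) σ = 0)) := by
  intro W _ _ hCM hred hsur K _ _ hK _ hH hodd hd3 htors hH2 Dt β ι _ hβ τ hτ1 u hu
  classical
  refine ⟨fun a ↦ 2 * a + 8, fun M e' q a hKol hq hqe hM hidx hshape ↦ ?_⟩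
  obtain ⟨g0, -, -, -, hsmall⟩ := hshape
  haveI : NeZero (2 ^ M) := ⟨pow_ne_zero M two_ne_zero⟩
  haveI hEK : (W.baseChange K).IsElliptic := by rw [baseChange]; infer_instance
  dsimp only
  have hle : torsionFixing (W.baseChange K) ((2 ^ (M + 1) : ℕ) : ℤ) ≤ torsionFixing (W.baseChange K) ((2 ^ M : ℕ) : ℤ) :=
    KolyvaginLowerBoundAtTwo.torsionFixing_le_of_dvd _ (by exact_mod_cast Nat.pow_dvd_pow 2 (Nat.le_succ M))
  have h2M : ∀ z : galH1Torsion (W.baseChange K) ((2 ^ M : ℕ) : ℤ), ((2 ^ M : ℕ) : ℤ) • z = 0 := fun z ↦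
    zsmul_galH1Torsion_eq_zero (W.baseChange K) _ z
  by_cases hMa : a + 8 ≤ M
  swap
  · -- the corner `M < a + 8`: `gR a ≥ M`, the frame `x := 0` works trivially
    refine ⟨fun _ ↦ 0, fun _ ↦ AddSubgroup.zero_mem _, fun _ ↦ by rw [map_zero, zsmul_zero], fun b _ i ↦ ?_, fun y _ _ ↦ ⟨fun _ ↦ 0, fun σ hσ ↦ ?_⟩⟩
    · rw [show M - (2 * a + 8) = 0 by omega, pow_zero]; exact one_dvd _
    · have hy0 : ((2 : ℤ) ^ (2 * a + 8)) • y = 0 := by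
        have h := KolyvaginLowerBoundAtTwo.two_pow_zsmul_eq_zero_of_le_swap (show M ≤ 2 * a + 8 by omega) (h2M y)
        rwa [show ((2 ^ (2 * a + 8) : ℕ) : ℤ) = (2 : ℤ) ^ (2 * a + 8) by rw [Nat.cast_pow, Nat.cast_ofNat]] at h
      rw [Fin.sum_univ_one, zsmul_zero, sub_zero, hy0]
      exact h1Eval_zero _ _ (hle hσ)
  -- main case `a + 8 ≤ M`: the frame data at level `2^M`
  have hs : (-u = 1 ∨ -u = -1) := by rcases hu with rfl | rfl <;> norm_num
  haveI : Finite (geomTorsion (W.baseChange K) ((2 ^ M : ℕ) : ℤ)) := finite_geomTorsion_of_neZero (W.baseChange K) (2 ^ M)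
  have hne4 : NumberField.discr K ≠ -4 := fun h ↦ by rw [h] at hodd; exact absurd hodd (by decide)
  have hD : NumberField.discr K < -4 := X11b.KolyvaginAssembly.discr_lt_neg_four hK ⟨hd3, hne4⟩
  obtain ⟨inv, hperf, hvan, -, hSC, hconj⟩ := InputsPoitouTateSelmer.poitouTate_selmerStructure_duality_conj_holds K (2 ^ M)
  obtain ⟨ew, hμ, hadd₁, hadd₂, hgal, halt, hnondeg, hτe⟩ := exists_weilDatum_liftAut_two_pow (K := K) W τ M
  -- the conductor `c = e·q` (`q` the new prime) and its place `v ∣ q`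
  have hn0 : e' * q ≠ 0 := hKol.1.ne_zero
  have hc : Squarefree (e' * q) := hKol.1
  have hqmem : q ∈ (e' * q).primeFactors := Nat.mem_primeFactors.mpr ⟨hq, dvd_mul_left q e', hn0⟩
  have hKolq : Zhang2014.IsKolyvaginPrime (W.conductorNorm ℤ) W K 2 q := hKol.2 q hqmem
  have hkM : ∀ ℓ ∈ (e' * q).primeFactors, M + 1 ≤ Zhang2014.kolyvaginIndex W 2 ℓ :=
    Zhang2014.natCast_le_levelIndex_iff.mp hidx
  have hkol : ∀ ℓ ∈ (e' * q).primeFactors, Zhang2014.IsKolyvaginPrime (W.conductorNorm ℤ) W K 2 ℓ := fun ℓ hℓ ↦ hKol.2 ℓ hℓ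
  obtain ⟨v, hv⟩ := exists_place_natCast_mem_of_kolyvaginPrime W hKolq
  have hfix : τ • v = v := smul_place_eq_self_of_natCast_mem τ hq.ne_zero hKolq.2.2.2.2.1 v hv
  have hτe' : ∀ S T, liftAutPlace τ hfix (ew S T) =
      ew ((isLiftOfAut_liftAutPlace τ hfix).torsionMap W ((2 ^ M : ℕ) : ℤ) S)
        ((isLiftOfAut_liftAutPlace τ hfix).torsionMap W ((2 ^ M : ℕ) : ℤ) T) :=
    weil_equivariant_of_isLiftOfAut W ((2 ^ M : ℕ) : ℤ) (isLiftOfAut_liftAutPlace τ hfix) (isLiftOfAut_liftAut τ)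
      ew hgal hτe
  -- the transverse family of `e·q` by its defining formula
  let 𝒯' : SelmerStructure ((W.baseChange K).torsionGaloisModule ((2 ^ M : ℕ) : ℤ)) := fun w ↦ match w with
    | Sum.inl _ => ⊤
    | Sum.inr w => ⨅ ℓ' ∈ (e' * q).primeFactors.filter (fun ℓ' : ℕ ↦ ((ℓ' : ℕ) : 𝓞 K) ∈ w.asIdeal),
        ⨅ (w' : HeightOneSpectrum (𝓞 (ringClassField K ι ℓ'))) (_ : w'.asIdeal.LiesOver w.asIdeal),
          letI := (adicCompletionOfLiesOver K (ringClassField K ι ℓ') w w').toAlgebra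
          transverseSubgroup (GaloisRep.toLocal w ((W.baseChange K).torsionGaloisModule ((2 ^ M : ℕ) : ℤ)))
            (w'.adicCompletion (ringClassField K ι ℓ'))
  have h𝒯' : ∀ w : HeightOneSpectrum (𝓞 K), 𝒯' (Sum.inr w) =
      ⨅ ℓ' ∈ (e' * q).primeFactors.filter (fun ℓ' : ℕ ↦ ((ℓ' : ℕ) : 𝓞 K) ∈ w.asIdeal),
        ⨅ (w' : HeightOneSpectrum (𝓞 (ringClassField K ι ℓ'))) (_ : w'.asIdeal.LiesOver w.asIdeal),
          letI := (adicCompletionOfLiesOver K (ringClassField K ι ℓ') w w').toAlgebra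
          transverseSubgroup (GaloisRep.toLocal w ((W.baseChange K).torsionGaloisModule ((2 ^ M : ℕ) : ℤ)))
            (w'.adicCompletion (ringClassField K ι ℓ')) := fun w ↦ rfl
  set 𝓛 := selmerF W ((2 ^ M : ℕ) : ℤ) 𝒯' (placesDividing K (e' * q)) with h𝓛def
  -- the two vertices in the walk's currency
  have hS'eq : 𝓛.selmerGroup = modifiedSelmerGroup W K ι ((2 ^ M : ℕ) : ℤ) (e' * q) :=
    selmerGroup_selmerF_eq_modifiedSelmerGroup_of_dvd W ι _ hc dvd_rfl 𝒯' h𝒯'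
  have hSeq : SelmerStructure.selmerGroup (Function.update 𝓛 (Sum.inr v : Place K)
        ((W.baseChange K).kummerSelmerStructure ((2 ^ M : ℕ) : ℤ) (Sum.inr v : Place K)) :
        SelmerStructure ((W.baseChange K).torsionGaloisModule ((2 ^ M : ℕ) : ℤ))) =
      modifiedSelmerGroup W K ι ((2 ^ M : ℕ) : ℤ) e' :=
    selmerGroup_update_kummer_eq_modifiedSelmerGroup W ι _ hc hq hKolq.2.2.2.2.1 hv 𝒯' h𝒯'
  -- `loc_v` in the `galH1Torsion` spelling
  let loc : galH1Torsion (W.baseChange K) ((2 ^ M : ℕ) : ℤ) →+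
      galoisCohomology (((W.baseChange K).torsionGaloisModule ((2 ^ M : ℕ) : ℤ)).toLocal (Sum.inr v : Place K)) 1 :=
    galoisCohomology.localization ((W.baseChange K).torsionGaloisModule ((2 ^ M : ℕ) : ℤ)) (Sum.inr v : Place K) 1
  -- the cut hypothesis: the shape `Sh(0, a)` read through Φ-KILL at `v`
  have hcut : ∀ y ∈ (SelmerStructure.selmerGroup (Function.update 𝓛 (Sum.inr v : Place K)
        ((W.baseChange K).kummerSelmerStructure ((2 ^ M : ℕ) : ℤ) (Sum.inr v : Place K)) :
        SelmerStructure ((W.baseChange K).torsionGaloisModule ((2 ^ M : ℕ) : ℤ)))),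
      (2 : ℤ) ^ a • (conjActPlace W τ ((2 ^ M : ℕ) : ℤ) hfix
          (galoisCohomology.localization ((W.baseChange K).torsionGaloisModule ((2 ^ M : ℕ) : ℤ)) (Sum.inr v : Place K) 1 y) +
        (-u) • galoisCohomology.localization ((W.baseChange K).torsionGaloisModule ((2 ^ M : ℕ) : ℤ))
          (Sum.inr v : Place K) 1 y) = 0 := by
    intro y hy
    rw [hSeq] at hy
    obtain ⟨y', rfl⟩ : ∃ y' : galH1Torsion (W.baseChange K) ((2 ^ M : ℕ) : ℤ), y' = y := ⟨y, rfl⟩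
    have hττ : τ * τ = 1 := by
      haveI : Algebra.IsQuadraticExtension ℚ K := ⟨hK.1⟩
      have hcard : Nat.card (K ≃ₐ[ℚ] K) = 2 := by rw [IsGalois.card_aut_eq_finrank, hK.1]
      haveI : Finite (K ≃ₐ[ℚ] K) := Nat.finite_of_card_ne_zero (by rw [hcard]; decide)
      have h : τ ^ Nat.card (K ≃ₐ[ℚ] K) = 1 := pow_card_eq_one'
      rw [hcard, pow_two] at h
      exact h
    have hss : (-u) * (-u) = 1 := by rcases hu with rfl | rfl <;> norm_num
    -- the symmetrised class `y'' = τ y' + s y' ∈ H_{𝓕(e)}` is an exact `(−u)`-eigenclass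
    have he'sq : Squarefree e' := hc.squarefree_of_dvd (dvd_mul_right e' q)
    have hy''S : conjAct W τ ((2 ^ M : ℕ) : ℤ) y' + (-u) • y' ∈ modifiedSelmerGroup W K ι ((2 ^ M : ℕ) : ℤ) e' :=
      AddSubgroup.add_mem _ (conjAct_mem_modifiedSelmerGroup W hK ι M he'sq hy τ) (AddSubgroup.zsmul_mem _ hy _)
    have hy''eig : conjAct W τ ((2 ^ M : ℕ) : ℤ) (conjAct W τ ((2 ^ M : ℕ) : ℤ) y' + (-u) • y') =
        (-u) • (conjAct W τ ((2 ^ M : ℕ) : ℤ) y' + (-u) • y') := by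
      rw [map_add, map_zsmul, conjAct_conjAct_of_mul_self W hττ]
      rcases hs with h1 | h1 <;> rw [h1]
      · simp only [one_zsmul]
        exact add_comm _ _
      · simp only [neg_one_zsmul, neg_add, neg_neg]
        exact add_comm _ _
    obtain ⟨b, hb⟩ := hsmall _ hy''S hy''eig
    have hres : ∀ ρ ∈ torsionFixing (W.baseChange K) ((2 ^ (M + 1) : ℕ) : ℤ),
        h1Eval (W.baseChange K) ((2 ^ M : ℕ) : ℤ)
          (((2 : ℤ) ^ a) • (conjAct W τ ((2 ^ M : ℕ) : ℤ) y' + (-u) • y')) ρ = 0 := fun ρ hρ ↦ by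
      have h := hb ρ hρ
      rwa [Finset.univ_eq_empty, Finset.sum_empty, sub_zero] at h
    have hkill := localization_eq_zero_of_res_eq_zero W hK hKolq (hkM q hqmem) v hv hres
    have e1 : loc (((2 : ℤ) ^ a) • (conjAct W τ ((2 ^ M : ℕ) : ℤ) y' + (-u) • y')) =
        (2 : ℤ) ^ a • (loc (conjAct W τ ((2 ^ M : ℕ) : ℤ) y') + loc ((-u) • y')) := by
      rw [map_zsmul, map_add]
    have e2 : loc ((-u) • y') = (-u) • loc y' := map_zsmul _ _ _
    have e3 : conjActPlace W τ ((2 ^ M : ℕ) : ℤ) hfix (loc y') = loc (conjAct W τ ((2 ^ M : ℕ) : ℤ) y') :=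
      conjActPlace_localization W τ _ hfix y'
    have hgoal : (2 : ℤ) ^ a • (conjActPlace W τ ((2 ^ M : ℕ) : ℤ) hfix (loc y') + (-u) • loc y') = 0 := by
      rw [e3, ← e2, ← e1]; exact hkill
    exact hgoal
  -- the refill class `x` (in-situ signed supply at `v`), with its LOCAL order
  obtain ⟨x, hxS, hxeig, hxne⟩ := RegularRefill.exists_eigen_mem_selmerF_of_symmetrised_cut W M ew hμ hadd₁ hadd₂ hgal
    halt hnondeg inv hK hD ι hM (e' * q) hc hkol hkM 𝒯' h𝒯' hperf hvan hSC hqmem v hv hτ1 hfix hs hτe' (hconj τ)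
    (a := a) hMa hcut
  have h𝓛v : 𝓛 (Sum.inr v) = 𝒯' (Sum.inr v) := by
    rw [h𝓛def, selmerF_inr, if_pos (RegularRefill.mem_placesDividing_of_mem_primeFactors hc hqmem v hv)]
  have hlocT : ∀ {z : galH1Torsion (W.baseChange K) ((2 ^ M : ℕ) : ℤ)}, z ∈ 𝓛.selmerGroup → loc z ∈ 𝒯' (Sum.inr v) :=
    fun {z} hz ↦ by
      have h := (SelmerStructure.mem_selmerGroup_iff _ _).mp hz (Sum.inr v)
      rwa [h𝓛v] at h
  have hloceig : ∀ {z : galH1Torsion (W.baseChange K) ((2 ^ M : ℕ) : ℤ)}, conjAct W τ ((2 ^ M : ℕ) : ℤ) z = (-u) • z →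
      conjActPlace W τ ((2 ^ M : ℕ) : ℤ) hfix (loc z) = (-u) • loc z := fun {z} hz ↦ by
    have e3 : conjActPlace W τ ((2 ^ M : ℕ) : ℤ) hfix (loc z) = loc (conjAct W τ ((2 ^ M : ℕ) : ℤ) z) :=
      conjActPlace_localization W τ _ hfix z
    have e2 : loc ((-u) • z) = (-u) • loc z := map_zsmul _ _ _
    rw [e3, hz, e2]
  have hxH : x ∈ modifiedSelmerGroup W K ι ((2 ^ M : ℕ) : ℤ) (e' * q) := by rw [← hS'eq]; exact hxS
  have h2Mloc : (2 : ℤ) ^ M • loc x = 0 := by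
    have h := X11b.KummerPT.nsmul_galoisCohomology_toLocal_eq_zero (W.baseChange K) (2 ^ M) (Sum.inr v) (loc x)
    rw [show ((2 : ℤ) ^ M) = ((2 ^ M : ℕ) : ℤ) by rw [Nat.cast_pow, Nat.cast_ofNat], natCast_zsmul]; exact h
  -- `H¹_{𝓛} ≤ H¹_{𝓛[v ↦ ⊤]}` and the previous vertex as `Rel ⊓ loc⁻¹ Kum`
  have hRel : 𝓛.selmerGroup ≤ SelmerStructure.selmerGroup (Function.update 𝓛 (Sum.inr v : Place K) ⊤ :
      SelmerStructure ((W.baseChange K).torsionGaloisModule ((2 ^ M : ℕ) : ℤ))) := by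
    have h := RegularRefill.selmerGroup_update_eq_inf_comap W M 𝓛 v (𝒯' (Sum.inr v))
    have hupd : Function.update 𝓛 (Sum.inr v : Place K) (𝒯' (Sum.inr v)) = 𝓛 := by rw [← h𝓛v, Function.update_eq_self]
    rw [hupd] at h
    rw [h]; exact inf_le_left
  have hSKum := RegularRefill.selmerGroup_update_eq_inf_comap W M 𝓛 v
    ((W.baseChange K).kummerSelmerStructure ((2 ^ M : ℕ) : ℤ) (Sum.inr v : Place K))
  refine ⟨fun _ ↦ x, fun _ ↦ hxH, fun _ ↦ hxeig, fun b hb i ↦ ?_, fun y hy hyeig ↦ ?_⟩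
  · -- near-freeness: a phantom multiple of `x` is locally trivial at `v` (Φ-KILL), so its coefficient is divisible by `ord(loc x)`
    have hb0 : ∀ σ ∈ torsionFixing (W.baseChange K) ((2 ^ (M + 1) : ℕ) : ℤ),
        h1Eval (W.baseChange K) ((2 ^ M : ℕ) : ℤ) (b 0 • x) σ = 0 := fun σ hσ ↦ by
      have h := hb σ hσ; rwa [Fin.sum_univ_one] at h
    have hkill := localization_eq_zero_of_res_eq_zero W hK hKolq (hkM q hqmem) v hv hb0
    have hbx : b 0 • loc x = 0 := by
      have e1 : loc (b 0 • x) = b 0 • loc x := map_zsmul _ _ _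
      rw [← e1]; exact hkill
    have hdvd := RegularRefill.two_pow_dvd_of_zsmul_eq_zero_of_ne_zero h2Mloc hxne hbx
    rw [Fin.fin_one_eq_zero i]
    exact (pow_dvd_pow 2 (by omega)).trans hdvd
  · -- absorption: `2^(a+8) loc y = t loc x`, then `w := 2^(a+8) y − t x ∈ H_{𝓕(e)}` and the shape `Sh(0,a)` finishes
    have hyS : y ∈ 𝓛.selmerGroup := by rw [hS'eq]; exact hy
    obtain ⟨t, ht⟩ := RegularRefill.exists_zsmul_eq_zsmul_of_transverse_eigen W M ew hμ hadd₁ hadd₂ hgal halt hnondeg inv hK hD ι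
      hM (e' * q) hc hkol hkM 𝒯' h𝒯' hperf hqmem v hv hτ1 hfix hs hτe' (hconj τ) (c₀ := a + 8) hMa
      (hlocT hxS) (hloceig hxeig) hxne (hlocT hyS) (hloceig hyeig)
    set w : galH1Torsion (W.baseChange K) ((2 ^ M : ℕ) : ℤ) := (2 : ℤ) ^ (a + 8) • y - t • x with hw
    have hlocw : loc w = 0 := by
      have e1 : loc w = loc ((2 : ℤ) ^ (a + 8) • y) - loc (t • x) := map_sub _ _ _
      have e2 : loc ((2 : ℤ) ^ (a + 8) • y) = (2 : ℤ) ^ (a + 8) • loc y := map_zsmul _ _ _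
      have e3 : loc (t • x) = t • loc x := map_zsmul _ _ _
      rw [e1, e2, e3, ht, sub_self]
    have hwS : w ∈ 𝓛.selmerGroup := AddSubgroup.sub_mem _ (AddSubgroup.zsmul_mem _ hyS _) (AddSubgroup.zsmul_mem _ hxS _)
    have hwE : w ∈ modifiedSelmerGroup W K ι ((2 ^ M : ℕ) : ℤ) e' := by
      rw [← hSeq, hSKum]
      refine AddSubgroup.mem_inf.mpr ⟨hRel hwS, AddSubgroup.mem_comap.mpr ?_⟩
      change loc w ∈ _
      rw [hlocw]
      exact AddSubgroup.zero_mem _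
    have hweig : conjAct W τ ((2 ^ M : ℕ) : ℤ) w = (-u) • w := by
      rw [hw, map_sub, map_zsmul, map_zsmul, hyeig, hxeig]
      exact zsmul_zsmul_sub_zsmul_zsmul (-u) _ t y x
    obtain ⟨b0, hb0⟩ := hsmall w hwE hweig
    have hres : ∀ ρ ∈ torsionFixing (W.baseChange K) ((2 ^ (M + 1) : ℕ) : ℤ),
        h1Eval (W.baseChange K) ((2 ^ M : ℕ) : ℤ) (((2 : ℤ) ^ a) • w) ρ = 0 := fun ρ hρ ↦ by
      have h := hb0 ρ hρ
      rwa [Finset.univ_eq_empty, Finset.sum_empty, sub_zero] at h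
    refine ⟨fun _ ↦ (2 : ℤ) ^ a * t, fun σ hσ ↦ ?_⟩
    rw [Fin.sum_univ_one, show 2 * a + 8 = (a + 8) + a by ring, RegularRefill.zsmul_sub_zsmul_mul_eq]
    exact hres σ hσ

end Summit.BirchSwinnertonDyer.BirchSwinnertonDyer.Theorems.KolyvaginAtTwo.RegularWalk

end
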